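import Summits.CriticalPhenomena.SAWScalingLimit.Theorems.SAWTensorRGRestrictionOfLimitRadoSides
import Literature.Topology.PlaneTopology.Schoenflies
import Mathlib.Analysis.SpecialFunctions.Complex.Log
import HarnessLib

/-!
# Radó squeezes, part 4: free arcs are two-sided; every defect point lies in a defect side

Support file (`--supports stmt-CriticalPhenomena-0773`, towards the registered stub `stub_radoSqueezeFamily`,
geometry F′ of the line `birth` for the crux `RestrictionOfLimit`). Pure plane topology.

Let `D' ⊆ D` be Dobrushin domains with common marked points, `ᾱ` the closed free arc of a free parameter `x`
of the window and `D ∖ ᾱ = U ⊔ U'` its two sides with `D' ⊆ U'` (part 3).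

* `side'_nhds_subset` (**two-sidedness of a free arc**): every point of the open free arc has a neighbourhood
  whose intersection with the `D'`-side `U'` lies in `D'`. Proof: by the Schoenflies theorem (tree,
  `JordanDomain.DiscChart.exists_homeomorph_eqOn`) `D' = G(𝔻)`, `∂D' = G(𝕋)`, `ℂ ∖ closure D' = G(ℂ ∖ 𝔻̄)` for a
  homeomorphism `G` of `ℂ`; around `ζ = G⁻¹ z ∈ 𝕋` the exponential box `V = ζ · exp (|re| < δ, |im| < δ)` is a
  neighbourhood whose outer half `V⁺ = ζ · exp (0 < re < δ, |im| < δ)` is connected, so `G(V⁺) ⊆ D ∖ ᾱ` lies in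
  one side; it meets `U` (as `z ∈ frontier U` and the rest of `G(V)` lies in `D' ∪ ᾱ`), hence `G(V⁺) ⊆ U`
  and `G(V) ∩ U' ⊆ G(V ∩ 𝔻) ⊆ D'`.
* `exists_free_of_mem_diff` (**every defect point lies in a defect side**): for `z ∈ D ∖ closure D'` there is
  a free parameter `x` of the window with `z ∈ U` for every valid pair of sides of its free arc. Proof: the
  component `C` of `z` in `D ∖ closure D'` has a frontier point `q` in `D` (else `C` would be clopen in the
  connected `D`), necessarily on `∂D'`, i.e. on an open free arc; `C ⊆ U ⊔ U'`, and `C ⊆ U'` is excluded by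
  two-sidedness at `q`.

References: Ch. Pommerenke, *Boundary Behaviour of Conformal Maps* (1992), §2.3 Cor. 2.8 (Schoenflies via
Carathéodory); M. H. A. Newman (1939), Ch. V §11. Axioms `propext`, `Classical.choice`, `Quot.sound`.
-/

noncomputable section

open Set Filter Topology Metric Complex
open Literature.Topology.PlaneTopology Literature.Probability.RandomPlanarGeometry

namespace Summit.CriticalPhenomena.SAWScalingLimit.Theorems.RestrictionOfLimit.Birth

/-! ### Exponential boxes around a point of the unit circle -/

/-- **Exponential boxes.** For `‖ζ‖ = 1` and `0 < δ ≤ 1`, the set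
`V = {y | y ζ⁻¹ ∈ slitPlane, |re log (y ζ⁻¹)| < δ, |im log (y ζ⁻¹)| < δ}` is an open neighbourhood of `ζ`, every
`y ∈ V` equals `ζ exp (log (y ζ⁻¹))` with `‖y‖ = exp (re log (y ζ⁻¹))`, and its outer part `V ∩ {1 < ‖y‖}` is
the image of the convex box `{0 < re w < δ, |im w| < δ}` under `w ↦ ζ exp w`, hence preconnected. [folklore] -/
theorem expBox_facts {ζ : ℂ} (hζ : ‖ζ‖ = 1) {δ : ℝ} (hδ : 0 < δ) (hδ1 : δ ≤ 1) :
    let V : Set ℂ := {y : ℂ | y * ζ⁻¹ ∈ slitPlane ∧ |(log (y * ζ⁻¹)).re| < δ ∧ |(log (y * ζ⁻¹)).im| < δ}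
    IsOpen V ∧ ζ ∈ V ∧ (∀ y ∈ V, y = ζ * exp (log (y * ζ⁻¹)) ∧ ‖y‖ = Real.exp (log (y * ζ⁻¹)).re) ∧
      IsPreconnected (V ∩ {y : ℂ | 1 < ‖y‖}) ∧
      (∀ y ∈ V, ‖ζ * exp (log (y * ζ⁻¹)) - ζ‖ = ‖exp (log (y * ζ⁻¹)) - 1‖) := by
  intro V
  have hζ0 : ζ ≠ 0 := fun h ↦ by rw [h, norm_zero] at hζ; exact zero_ne_one hζ
  have hopen0 : IsOpen {y : ℂ | y * ζ⁻¹ ∈ slitPlane} := isOpen_slitPlane.preimage (continuous_id.mul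
      continuous_const)
  have hcont : ContinuousOn (fun y : ℂ ↦ log (y * ζ⁻¹)) {y : ℂ | y * ζ⁻¹ ∈ slitPlane} := fun y hy ↦ by
    have h : ContinuousAt (fun y : ℂ ↦ log (y * ζ⁻¹)) y :=
      ContinuousAt.comp' (f := fun y : ℂ ↦ y * ζ⁻¹) (continuousAt_clog hy) (by fun_prop)
    exact h.continuousWithinAt
  have hV : V = {y : ℂ | y * ζ⁻¹ ∈ slitPlane} ∩
      (fun y : ℂ ↦ log (y * ζ⁻¹)) ⁻¹' {w : ℂ | |w.re| < δ ∧ |w.im| < δ} := by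
    ext y; simp [V]
  have hbox : IsOpen {w : ℂ | |w.re| < δ ∧ |w.im| < δ} :=
    (isOpen_lt (continuous_abs.comp continuous_re) continuous_const).inter
      (isOpen_lt (continuous_abs.comp continuous_im) continuous_const)
  refine ⟨?_, ?_, fun y hy ↦ ?_, ?_, fun y _ ↦ ?_⟩
  · rw [hV]
    exact hcont.isOpen_inter_preimage hopen0 hbox
  · refine ⟨?_, ?_, ?_⟩
    · rw [mul_inv_cancel₀ hζ0]; exact Complex.one_mem_slitPlane
    · rw [mul_inv_cancel₀ hζ0, log_one]; simpa using hδ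
    · rw [mul_inv_cancel₀ hζ0, log_one]; simpa using hδ
  · have hy0 : y * ζ⁻¹ ≠ 0 := slitPlane_ne_zero hy.1
    constructor
    · rw [exp_log hy0, mul_comm, inv_mul_cancel_right₀ hζ0]
    · conv_lhs => rw [show y = ζ * exp (log (y * ζ⁻¹)) by rw [exp_log hy0, mul_comm, inv_mul_cancel_right₀ hζ0]]
      rw [norm_mul, hζ, one_mul, norm_exp]
  · -- the outer part is the image of a convex box
    have heq : V ∩ {y : ℂ | 1 < ‖y‖} =
        (fun w : ℂ ↦ ζ * exp w) '' {w : ℂ | 0 < w.re ∧ w.re < δ ∧ |w.im| < δ} := by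
      ext y
      constructor
      · rintro ⟨hy, hy1⟩
        have hy0 : y * ζ⁻¹ ≠ 0 := slitPlane_ne_zero hy.1
        have hyeq : y = ζ * exp (log (y * ζ⁻¹)) := by rw [exp_log hy0, mul_comm, inv_mul_cancel_right₀ hζ0]
        have hnorm : ‖y‖ = Real.exp (log (y * ζ⁻¹)).re := by
          conv_lhs => rw [hyeq]
          rw [norm_mul, hζ, one_mul, norm_exp]
        refine ⟨log (y * ζ⁻¹), ⟨?_, (abs_lt.1 hy.2.1).2, hy.2.2⟩, hyeq.symm⟩
        have : (1 : ℝ) < Real.exp (log (y * ζ⁻¹)).re := hnorm ▸ hy1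
        rwa [Real.one_lt_exp_iff] at this
      · rintro ⟨w, ⟨hw0, hwδ, hwim⟩, rfl⟩
        have hwim' : |w.im| < Real.pi / 2 := lt_of_lt_of_le hwim (hδ1.trans (by linarith [Real.two_le_pi]))
        have hslit : exp w ∈ slitPlane := by
          rw [mem_slitPlane_iff]
          left
          rw [exp_re]
          exact mul_pos (Real.exp_pos _) (Real.cos_pos_of_mem_Ioo (abs_lt.1 hwim'))
        have hlog : log (exp w) = w :=
          log_exp (by linarith [(abs_lt.1 hwim').1, Real.two_le_pi]) (by linarith [(abs_lt.1 hwim').2,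
              Real.two_le_pi])
        have hmul : ζ * exp w * ζ⁻¹ = exp w := by rw [mul_comm ζ, mul_assoc, mul_inv_cancel₀ hζ0, mul_one]
        refine ⟨⟨by rw [hmul]; exact hslit, ?_, ?_⟩, ?_⟩
        · rw [hmul, hlog]; exact abs_lt.2 ⟨by linarith, hwδ⟩
        · rw [hmul, hlog]; exact hwim
        · show 1 < ‖ζ * exp w‖
          rw [norm_mul, hζ, one_mul, norm_exp, Real.one_lt_exp_iff]
          exact hw0
    rw [heq]
    refine (Convex.isPreconnected ?_).image _ (by fun_prop)
    have h1 : Convex ℝ {w : ℂ | 0 < w.re} := convex_halfSpace_re_gt 0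
    have h2 : Convex ℝ {w : ℂ | w.re < δ} := convex_halfSpace_re_lt δ
    have h3 : Convex ℝ {w : ℂ | w.im < δ} := convex_halfSpace_im_lt δ
    have h4 : Convex ℝ {w : ℂ | -δ < w.im} := convex_halfSpace_im_gt (-δ)
    have : {w : ℂ | 0 < w.re ∧ w.re < δ ∧ |w.im| < δ} =
        {w : ℂ | 0 < w.re} ∩ {w : ℂ | w.re < δ} ∩ ({w : ℂ | w.im < δ} ∩ {w : ℂ | -δ < w.im}) := by
      ext w
      simp only [abs_lt, mem_setOf_eq, mem_inter_iff]
      tauto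
    rw [this]
    exact (h1.inter h2).inter (h3.inter h4)
  · rw [← mul_sub_one, norm_mul, hζ, one_mul]

/-! ### Two-sidedness of free arcs -/

/-- **Free arcs are two-sided.** With the notation of the module docstring, every point of the open free arc
has a neighbourhood `O` with `O ∩ U' ⊆ D'`. [folklore] -/
theorem side'_nhds_subset {D D' : DobrushinDomain} {F : Set ℝ} (hF : F = {θ : ℝ | D'.boundary θ ∈ D.carrier})
    (h0 : D'.pt 0 = D.pt 0) (h1 : D'.pt 1 = D.pt 1) {x : ℝ} (hx : x ∈ F)
    (hxw : x ∈ Ioo (D'.mark 0) (D'.mark 0 + 1)) {U U' : Set ℂ} {s t : ℝ} (hUo : IsOpen U) (hU'o : IsOpen U')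
    (hdisj : Disjoint U U')
    (hunion : U ∪ U' = D.carrier \
      (D'.boundary '' Icc (sInf (connectedComponentIn F x)) (sSup (connectedComponentIn F x))))
    (hfrU : frontier U = (D'.boundary '' Icc (sInf (connectedComponentIn F x)) (sSup (connectedComponentIn F x))) ∪
      D.boundary '' Icc s t)
    (hD'U : D'.carrier ⊆ U') {θ : ℝ}
    (hθ : θ ∈ Ioo (sInf (connectedComponentIn F x)) (sSup (connectedComponentIn F x))) :
    ∃ O ∈ 𝓝 (D'.boundary θ), O ∩ U' ⊆ D'.carrier := by
  obtain ⟨hcc, -, -, -, -, hix, hxs, -⟩ := free_component hF h0 h1 hx hxw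
  set z : ℂ := D'.boundary θ with hz_def
  set αbar : Set ℂ := D'.boundary '' Icc (sInf (connectedComponentIn F x)) (sSup (connectedComponentIn F x))
    with hαbar
  have hzα : z ∈ αbar := ⟨θ, ⟨hθ.1.le, hθ.2.le⟩, rfl⟩
  have hzD : z ∈ D.carrier := ((free_image_Ioo_subset hF h0 h1 hx hxw) ⟨θ, hθ, rfl⟩).1
  have hαcl : αbar ⊆ closure D'.carrier := by
    rintro _ ⟨v, -, rfl⟩; exact frontier_subset_closure (D'.boundary_mem_frontier v)
  -- Schoenflies chart of `D'`
  obtain ⟨z₀, hz₀⟩ := D'.nonempty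
  obtain ⟨C, -⟩ := D'.toJordanDomain.exists_discChart_apply_eq hz₀
  obtain ⟨G, -, hGball, hGsph, -, hGext⟩ := C.exists_homeomorph_eqOn
  have hmem_ball : ∀ y, G y ∈ D'.carrier ↔ y ∈ ball (0 : ℂ) 1 := fun y ↦ by
    rw [← hGball, G.injective.mem_set_image]
  have hmem_sph : ∀ y, G y ∈ frontier D'.carrier ↔ y ∈ sphere (0 : ℂ) 1 := fun y ↦ by
    rw [← hGsph, G.injective.mem_set_image]
  have hmem_ext : ∀ y, G y ∈ (closure D'.carrier)ᶜ ↔ y ∈ (closedBall (0 : ℂ) 1)ᶜ := fun y ↦ by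
    rw [← hGext, G.injective.mem_set_image]
  set ζ : ℂ := G.symm z with hζ_def
  have hGζ : G ζ = z := G.apply_symm_apply z
  have hζ1 : ‖ζ‖ = 1 := by
    have : G ζ ∈ frontier D'.carrier := hGζ ▸ D'.boundary_mem_frontier θ
    exact mem_sphere_zero_iff_norm.1 ((hmem_sph ζ).1 this)
  -- the good neighbourhood `O₀ = D ∖ K` of `z`, `K` the complementary closed arc
  set K : Set ℂ := D'.boundary '' Icc (sSup (connectedComponentIn F x)) (sInf (connectedComponentIn F x) + 1)
    with hK
  have hKc : IsClosed K := (isCompact_Icc.image D'.continuous_boundary).isClosed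
  have hzK : z ∉ K := free_notMem_compl_arc hF h0 h1 hx hxw hθ
  have hO₀ : D.carrier ∩ Kᶜ ∈ 𝓝 z := (D.isOpen.inter hKc.isOpen_compl).mem_nhds ⟨hzD, hzK⟩
  have hfrO₀ : ∀ q ∈ D.carrier ∩ Kᶜ, q ∈ frontier D'.carrier → q ∈ αbar := fun q hq hqfr ↦ by
    obtain ⟨v, hv, rfl⟩ := frontier_diff_compl_arc_subset hF h0 h1 hx hxw ⟨hqfr, hq.2⟩
    exact ⟨v, ⟨hv.1.le, hv.2.le⟩, rfl⟩
  -- an exponential box inside the preimage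
  have hpre : G ⁻¹' (D.carrier ∩ Kᶜ) ∈ 𝓝 ζ := G.continuous.continuousAt.preimage_mem_nhds (by rwa [hGζ])
  have hexp0 : ContinuousAt (fun w : ℂ ↦ ζ * exp w) 0 := by fun_prop
  have hpre' : (fun w : ℂ ↦ ζ * exp w) ⁻¹' (G ⁻¹' (D.carrier ∩ Kᶜ)) ∈ 𝓝 (0 : ℂ) :=
    hexp0.preimage_mem_nhds (by simpa using hpre)
  obtain ⟨r, hr, hrsub⟩ := Metric.mem_nhds_iff.1 hpre'
  set δ : ℝ := min (r / 2) 1 with hδ_def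
  have hδ : 0 < δ := lt_min (by linarith) one_pos
  have hδ1 : δ ≤ 1 := min_le_right _ _
  have hδr : 2 * δ ≤ r := by have := min_le_left (r / 2) 1; linarith
  obtain ⟨hVo, hζV, hVlog, hVconn, -⟩ := expBox_facts hζ1 hδ hδ1
  set V : Set ℂ := {y : ℂ | y * ζ⁻¹ ∈ slitPlane ∧ |(log (y * ζ⁻¹)).re| < δ ∧ |(log (y * ζ⁻¹)).im| < δ} with hV
  -- `G '' V ⊆ D ∖ K`
  have hGV : ∀ y ∈ V, G y ∈ D.carrier ∩ Kᶜ := fun y hy ↦ by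
    obtain ⟨hyeq, -⟩ := hVlog y hy
    have hw : log (y * ζ⁻¹) ∈ ball (0 : ℂ) r := by
      rw [mem_ball_zero_iff]
      calc ‖log (y * ζ⁻¹)‖ ≤ |(log (y * ζ⁻¹)).re| + |(log (y * ζ⁻¹)).im| := Complex.norm_le_abs_re_add_abs_im _
        _ < δ + δ := add_lt_add hy.2.1 hy.2.2
        _ ≤ r := by linarith
    have := hrsub hw
    simp only [mem_preimage] at this
    rwa [← hyeq] at this
  -- the outer part goes into one side, in fact into `U`
  have hVplus_sub : G '' (V ∩ {y : ℂ | 1 < ‖y‖}) ⊆ U ∪ U' := by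
    rw [hunion]
    rintro _ ⟨y, ⟨hyV, hy1⟩, rfl⟩
    refine ⟨(hGV y hyV).1, fun hα ↦ ?_⟩
    have hext : G y ∈ (closure D'.carrier)ᶜ := (hmem_ext y).2 fun h ↦ by
      have := mem_closedBall_zero_iff.1 h; exact absurd hy1 (not_lt.2 this)
    exact hext (hαcl hα)
  have hzfrU : z ∈ frontier U := by rw [hfrU]; exact Or.inl hzα
  have hGVnhds : G '' V ∈ 𝓝 z := by
    rw [← hGζ]
    exact G.isOpenMap.image_mem_nhds (hVo.mem_nhds hζV)
  obtain ⟨q, hqGV, hqU⟩ := mem_closure_iff_nhds.1 (frontier_subset_closure hzfrU) _ hGVnhds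
  obtain ⟨y, hyV, rfl⟩ := hqGV
  have hy1 : 1 < ‖y‖ := by
    by_contra hle
    rw [not_lt] at hle
    rcases hle.lt_or_eq with hlt | heq
    · -- inside the disc: `G y ∈ D' ⊆ U'`
      have : G y ∈ D'.carrier := (hmem_ball y).2 (mem_ball_zero_iff.2 hlt)
      exact Set.disjoint_left.1 hdisj hqU (hD'U this)
    · -- on the circle: `G y ∈ ∂D' ∩ (D ∖ K) ⊆ ᾱ`, off `U`
      have hfr : G y ∈ frontier D'.carrier := (hmem_sph y).2 (mem_sphere_zero_iff_norm.2 heq)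
      have hα : G y ∈ αbar := hfrO₀ _ (hGV y hyV) hfr
      have : G y ∈ D.carrier \ αbar := by rw [← hunion]; exact Or.inl hqU
      exact this.2 hα
  have hVplusU : G '' (V ∩ {y : ℂ | 1 < ‖y‖}) ⊆ U := by
    rcases (hVconn.image _ G.continuous.continuousOn).subset_or_subset hUo hU'o hdisj hVplus_sub with h | h
    · exact h
    · exact absurd (h ⟨y, ⟨hyV, hy1⟩, rfl⟩) (Set.disjoint_left.1 hdisj hqU)
  -- conclusion
  refine ⟨G '' V, hGVnhds, ?_⟩
  rintro _ ⟨⟨y', hy'V, rfl⟩, hy'U'⟩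
  rcases lt_trichotomy ‖y'‖ 1 with hlt | heq | hgt
  · exact (hmem_ball y').2 (mem_ball_zero_iff.2 hlt)
  · exfalso
    have hfr : G y' ∈ frontier D'.carrier := (hmem_sph y').2 (mem_sphere_zero_iff_norm.2 heq)
    have hα : G y' ∈ αbar := hfrO₀ _ (hGV y' hy'V) hfr
    have : G y' ∈ D.carrier \ αbar := by rw [← hunion]; exact Or.inr hy'U'
    exact this.2 hα
  · exact absurd hy'U' (Set.disjoint_left.1 hdisj (hVplusU ⟨y', ⟨hy'V, hgt⟩, rfl⟩))

/-! ### Every defect point lies in a defect side -/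

/-- **Every point of `D ∖ closure D'` lies in the defect side of some free arc** (for every valid pair of sides
of that arc). [folklore] -/
theorem exists_free_of_mem_diff {D D' : DobrushinDomain} {F : Set ℝ} (hF : F = {θ : ℝ | D'.boundary θ ∈ D.carrier})
    (hsub : D'.carrier ⊆ D.carrier) (h0 : D'.pt 0 = D.pt 0) (h1 : D'.pt 1 = D.pt 1) {z : ℂ}
    (hzD : z ∈ D.carrier) (hzcl : z ∉ closure D'.carrier) :
    ∃ x ∈ F, x ∈ Ioo (D'.mark 0) (D'.mark 0 + 1) ∧ ∀ (U U' : Set ℂ) (s t : ℝ), IsOpen U → IsOpen U' →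
      Disjoint U U' →
      U ∪ U' = D.carrier \ (D'.boundary '' Icc (sInf (connectedComponentIn F x)) (sSup (connectedComponentIn F
          x))) →
      frontier U = (D'.boundary '' Icc (sInf (connectedComponentIn F x)) (sSup (connectedComponentIn F x))) ∪
        D.boundary '' Icc s t →
      D'.carrier ⊆ U' → z ∈ U := by
  set S : Set ℂ := D.carrier \ closure D'.carrier with hS
  have hSo : IsOpen S := D.isOpen.sdiff isClosed_closure
  have hzS : z ∈ S := ⟨hzD, hzcl⟩
  set C : Set ℂ := connectedComponentIn S z with hC
  have hCo : IsOpen C := hSo.connectedComponentIn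
  have hzC : z ∈ C := mem_connectedComponentIn hzS
  have hCS : C ⊆ S := connectedComponentIn_subset S z
  have hCc : IsPreconnected C := isPreconnected_connectedComponentIn
  -- a frontier point of `C` inside `D`
  have hq : ∃ q ∈ frontier C, q ∈ D.carrier := by
    by_contra hno
    push Not at hno
    have hDC : D.carrier ⊆ C := by
      refine D.isConnected.isPreconnected.subset_of_closure_inter_subset hCo ⟨z, hzD, hzC⟩ ?_
      rintro q ⟨hqcl, hqD⟩
      by_contra hqC
      exact hno q ⟨hqcl, by rwa [hCo.interior_eq]⟩ hqD
    obtain ⟨p, hp⟩ := D'.nonempty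
    exact (hCS (hDC (hsub hp))).2 (subset_closure hp)
  obtain ⟨q, hqfr, hqD⟩ := hq
  have hqC : q ∉ C := fun h ↦ by
    have := hqfr.2; rw [hCo.interior_eq] at this; exact this h
  have hqS : q ∉ S := fun hqS ↦ by
    have hnhds : connectedComponentIn S q ∈ 𝓝 q := hSo.connectedComponentIn.mem_nhds (mem_connectedComponentIn hqS)
    obtain ⟨c, hcq, hcC⟩ := mem_closure_iff_nhds.1 hqfr.1 _ hnhds
    have h1' : connectedComponentIn S q = connectedComponentIn S c := connectedComponentIn_eq hcq
    have h2' : connectedComponentIn S z = connectedComponentIn S c := connectedComponentIn_eq hcC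
    exact hqC (by rw [hC, h2', ← h1']; exact mem_connectedComponentIn hqS)
  have hqcl : q ∈ closure D'.carrier := by
    by_contra h; exact hqS ⟨hqD, h⟩
  have hqD' : q ∉ D'.carrier := fun h ↦ by
    obtain ⟨c, hcD', hcC⟩ := mem_closure_iff_nhds.1 hqfr.1 _ (D'.isOpen.mem_nhds h)
    exact (hCS hcC).2 (subset_closure hcD')
  have hqfr' : q ∈ frontier D'.carrier := by
    rw [frontier, D'.isOpen.interior_eq]; exact ⟨hqcl, hqD'⟩
  rw [← D'.range_boundary] at hqfr'
  obtain ⟨θ₀, hθ₀⟩ := hqfr'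
  have hθ₀F : θ₀ ∈ F := (mem_free_iff hF θ₀).2 (hθ₀ ▸ hqD)
  obtain ⟨x, hx, hxw, hxq⟩ := free_normalise hF h0 h1 hθ₀F
  refine ⟨x, hx, hxw, fun U U' s t hUo hU'o hdisj hunion hfrU hD'U ↦ ?_⟩
  obtain ⟨-, -, -, -, -, hix, hxs, -⟩ := free_component hF h0 h1 hx hxw
  -- `C` lies in one side
  have hCsub : C ⊆ U ∪ U' := by
    rw [hunion]
    refine fun c hc ↦ ⟨(hCS hc).1, ?_⟩
    rintro ⟨v, -, hvc⟩
    exact (hCS hc).2 (hvc ▸ frontier_subset_closure (D'.boundary_mem_frontier v))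
  rcases hCc.subset_or_subset hUo hU'o hdisj hCsub with h | h
  · exact h hzC
  · exfalso
    obtain ⟨O, hO, hOU'⟩ := side'_nhds_subset hF h0 h1 hx hxw hUo hU'o hdisj hunion hfrU hD'U ⟨hix, hxs⟩
    rw [hxq, hθ₀] at hO
    obtain ⟨c, hcO, hcC⟩ := mem_closure_iff_nhds.1 hqfr.1 _ hO
    exact (hCS hcC).2 (subset_closure (hOU' ⟨hcO, h hcC⟩))

/-- **Registered helper stub `stub_radoTwoSided`** (towards `stub_radoSqueezeFamily`, line `birth`): every point
of `D ∖ closure D'` lies in the defect side of some free arc, in closed form. [folklore] -/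
theorem stub_radoTwoSided :
    ∀ (D D' : DobrushinDomain) (F : Set ℝ), F = {θ : ℝ | D'.boundary θ ∈ D.carrier} →
      D'.carrier ⊆ D.carrier → D'.pt 0 = D.pt 0 → D'.pt 1 = D.pt 1 → ∀ z : ℂ, z ∈ D.carrier →
      z ∉ closure D'.carrier →
      ∃ x ∈ F, x ∈ Set.Ioo (D'.mark 0) (D'.mark 0 + 1) ∧ ∀ (U U' : Set ℂ) (s t : ℝ), IsOpen U → IsOpen U' →
        Disjoint U U' →
        U ∪ U' = D.carrier \
          (D'.boundary '' Set.Icc (sInf (connectedComponentIn F x)) (sSup (connectedComponentIn F x))) →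
        frontier U = (D'.boundary '' Set.Icc (sInf (connectedComponentIn F x)) (sSup (connectedComponentIn F x))) ∪
          D.boundary '' Set.Icc s t →
        D'.carrier ⊆ U' → z ∈ U :=
  fun _ _ _ hF hsub h0 h1 _ hzD hzcl ↦ exists_free_of_mem_diff hF hsub h0 h1 hzD hzcl

end Summit.CriticalPhenomena.SAWScalingLimit.Theorems.RestrictionOfLimit.Birth

end
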